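import Summits.FinalStateConjecture.FinalStateConjecture.Theses.RootDecompTrappedGauge

/-!
# The glue item `TrappedExitGlueR` of route `RootDecompTrappedGauge` holds

`TrappedExitGlueR := InitiallyTrappedExitR → TrappedGaugeDescentR → SliceHiddenTrappedExitR → TrappedExit`
(route `RootDecompTrappedGauge`, rev 2; ledger item `stmt-FinalStateConjecture-30553`, the glue of the split of
`TrappedExit` into `InitiallyTrappedExitR` / `TrappedGaugeDescentR` / `SliceHiddenTrappedExitR`).

Proof: two excluded middles, on «some admissible slice-gauge relative of `d` is regularly trapped on arrival»
(the last antecedent of `SliceHiddenTrappedExitR`) and on «`d` itself is regularly trapped on arrival» (the last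
antecedent of `InitiallyTrappedExitR`), written by contradiction so that neither predicate has to be spelled out:
assuming `¬ Cure d`, `SliceHiddenTrappedExitR` reduces the goal to the gauge-trapped case, `TrappedGaugeDescentR`
reduces that case to the initially-trapped case for `d` or for a gauge relative `d'`, and `InitiallyTrappedExitR`
closes both.  Pure logic on the route's own declarations; no mathematics of the cells is used.
-/

-- D-0017: single-problem summit, `Summit.<S>.<S>.…` by design (cf. lakefile `weak.linter.dupNamespace`).
set_option linter.dupNamespace false

namespace Summit.FinalStateConjecture.FinalStateConjecture.Theorems.RootDecompTrappedGaugeTrappedExitGlueR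

open Summit.FinalStateConjecture.FinalStateConjecture.Theses.RootDecompTrappedGauge

/-- **Glue′**: `InitiallyTrappedExitR → TrappedGaugeDescentR → SliceHiddenTrappedExitR → TrappedExit`. -/
theorem trappedExitGlueR : TrappedExitGlueR :=
  fun hA hR hZ X _ _ _ _ _ _ d hd hP hT ↦ Classical.byContradiction fun hC ↦
    hC (hZ X d hd hP hT fun hG ↦
      hC (hR X d hd hP hT (fun hD ↦ hC (hA X d hd hP hT hD)) hG
        fun d' hd' _ hP' hT' hD' ↦ hA X d' hd' hP' hT' hD'))

end Summit.FinalStateConjecture.FinalStateConjecture.Theorems.RootDecompTrappedGaugeTrappedExitGlueR
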